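import Mathlib.Topology.Instances.Shrink
import Literature.Topology.FourManifolds.GluckTwistMeridian
import Literature.Topology.FourManifolds.Handles
import Literature.Topology.FourManifolds.SmoothOrientationGluing
import HarnessLib

/-!
# Manifold structure on `Shrink M`: moving manifolds and Morse data DOWN (or across) universes

Topic `Literature/Topology/FourManifolds`; general infrastructure, companion of `ManifoldULift.lean`.
`ULift.{v} M : Type (max u v)` only RAISES the universe of a manifold `M : Type u`; the named facts
of the topic quantify over manifolds in an arbitrary universe (`msz_homotopySphere_gk.{u}`,
`az2025_weaklyReducible_genusThree_homotopySphere_gk.{u}`, `exists_isBalancedGKTrisection.{u}`, …)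
and carry existential witnesses `W : Type u` (the pieces of a Gay–Kirby trisection,
`IsGKTrisection`), so that deducing the fact at universe `u` from its instance at universe `0` —
where the concrete models live — needs the opposite move: a copy of `M` in a SMALLER universe
with the same charts.  Mathlib's `Shrink.{v} M : Type v` (for `Small.{v} M`; every second
countable `T₁` space is `v`-small for every `v`, `small_of_secondCountableTopology`) with the
topology of `Mathlib.Topology.Instances.Shrink` is that copy; this file gives it the charted-space
and `C^n` structures TRANSPORTED along `Shrink.homeomorph M : M ≃ₜ Shrink M`
(`Homeomorph.transportChartedSpace`, `GluckTwistMeridian.lean`: charts `sh ≫ e` for the charts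
`e` of `M`, `sh = (Shrink.homeomorph M)⁻¹`), as GLOBAL instances, and proves — exactly as
`ManifoldULift.lean` does for `ULift` — that Morse data are unchanged:

* §1 `ManifoldShrink.instChartedSpace`, `instIsManifold`, chart formulas
  (`extChartAt I x y = extChartAt I (sh x) (sh y)`), topological instances;
* §2 the diffeomorphism `ManifoldShrink.diffeomorph I M n : Shrink M ≃ₘ^n⟮I, I⟯ M` (it is `sh`);
* §3 Morse data of `f ∘ sh` versus `f` (`Morse.lean`): `writtenInExtChartAt`, `mfderiv`,
  critical points, Hessian, index, counts, `IsMorse`, boundary / interior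
  (`boundary_eq : I.boundary (Shrink M) = sh ⁻¹' I.boundary M`), `IsMorseAdapted`, and hence
  `ManifoldShrink.hasHandleDecomposition` (`Handles.lean`).

The one difference with `ULift`: `sh (sh⁻¹ x) = x` holds propositionally
(`Homeomorph.symm_apply_apply`), not by `rfl`, so a few `rfl`s of `ManifoldULift.lean` become
rewrites.  Everything here is proved; no named fact is introduced.

## References

* J. M. Lee, *Introduction to Smooth Manifolds*, 2nd ed., GTM 218 (2013), Ch. 1 (smooth
  structures transported along homeomorphisms; diffeomorphism invariance). [LeeSmoothManifolds2013]
* J. Milnor, *Morse theory*, Ann. of Math. Studies 51 (1963), §2 (critical points, Hessian and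
  index are defined in charts). [Milnor1963]
-/

open scoped Manifold ContDiff Topology
open Set Function Filter

noncomputable section

namespace Literature.Topology.FourManifolds

universe v u

namespace ManifoldShrink

variable {H : Type*} [TopologicalSpace H] {M : Type u} [TopologicalSpace M] [Small.{v} M]

/-- The homeomorphism `sh : Shrink M ≃ₜ M` (inverse of Mathlib's `Shrink.homeomorph M`).
[folklore] -/
abbrev sh (M : Type u) [TopologicalSpace M] [Small.{v} M] : Shrink.{v} M ≃ₜ M :=
  (Shrink.homeomorph M).symm

/-- `sh⁻¹ (sh x) = x`. [folklore] -/
@[simp] theorem symm_sh_apply (x : Shrink.{v} M) : (sh M).symm (sh M x) = x :=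
  (sh M).symm_apply_apply x

/-- `sh (sh⁻¹ x) = x`. [folklore] -/
@[simp] theorem sh_symm_apply (x : M) : sh M ((sh.{v} M).symm x) = x :=
  (sh M).apply_symm_apply x

variable [ChartedSpace H M]

/-- **The charted space structure on `Shrink M`**: charts `sh ≫ e` for the charts `e` of `M` —
the structure of `M` transported along `Shrink.homeomorph M` (`Homeomorph.transportChartedSpace`,
so that it agrees DEFINITIONALLY with the local instances used in `SPC4Wave0Proofs.lean`,
`HomotopySphereSummandsHolds.lean`). [folklore] -/
instance instChartedSpace : ChartedSpace H (Shrink.{v} M) :=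
  Homeomorph.transportChartedSpace (Shrink.homeomorph M)

/-- The preferred chart of `Shrink M` at `x` is `sh ≫ chartAt (sh x)`. [folklore] -/
theorem chartAt_eq (x : Shrink.{v} M) :
    chartAt H x = (sh M).toOpenPartialHomeomorph ≫ₕ chartAt H (sh M x) := rfl

/-- Charts of `Shrink M` evaluate as charts of `M`. [folklore] -/
@[simp] theorem chartAt_apply (x y : Shrink.{v} M) : chartAt H x y = chartAt H (sh M x) (sh M y) :=
  rfl

/-- Inverse charts of `Shrink M`. [folklore] -/
@[simp] theorem chartAt_symm_apply (x : Shrink.{v} M) (z : H) :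
    (chartAt H x).symm z = (sh M).symm ((chartAt H (sh M x)).symm z) := rfl

/-- Chart sources of `Shrink M`. [folklore] -/
theorem chartAt_source_shrink (x : Shrink.{v} M) :
    (chartAt H x).source = sh M ⁻¹' (chartAt H (sh M x)).source := by
  rw [chartAt_eq, OpenPartialHomeomorph.trans_source]
  simp

/-- Chart targets of `Shrink M`. [folklore] -/
theorem chartAt_target_shrink (x : Shrink.{v} M) :
    (chartAt H x).target = (chartAt H (sh M x)).target := by
  rw [chartAt_eq, OpenPartialHomeomorph.trans_target]
  simp

/-- **`Shrink M` has the same structure groupoid as `M`.** [folklore] -/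
instance instHasGroupoid (G : StructureGroupoid H) [HasGroupoid M G] :
    HasGroupoid (Shrink.{v} M) G :=
  Homeomorph.hasGroupoid_transportChartedSpace (Shrink.homeomorph M) G

variable {E : Type*} [NormedAddCommGroup E] [NormedSpace ℝ E] {I : ModelWithCorners ℝ E H}
  {n : WithTop ℕ∞}

/-- **`Shrink M` is a `Cⁿ` manifold when `M` is.** [folklore] -/
instance instIsManifold [IsManifold I n M] : IsManifold I n (Shrink.{v} M) :=
  Homeomorph.isManifold_transportChartedSpace (I₀ := I) (n := n) (Shrink.homeomorph M)

/-- The extended charts of `Shrink M`: `extChartAt I x = extChartAt I (sh x) ∘ sh`. [folklore] -/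
@[simp] theorem extChartAt_apply (x y : Shrink.{v} M) :
    extChartAt I x y = extChartAt I (sh M x) (sh M y) := rfl

/-- Inverse extended charts of `Shrink M`. [folklore] -/
@[simp] theorem extChartAt_symm_apply (x : Shrink.{v} M) (z : E) :
    (extChartAt I x).symm z = (sh M).symm ((extChartAt I (sh M x)).symm z) := rfl

/-- Extended chart sources of `Shrink M`. [folklore] -/
theorem extChartAt_source_shrink (x : Shrink.{v} M) :
    (extChartAt I x).source = sh M ⁻¹' (extChartAt I (sh M x)).source := by
  simp only [extChartAt_source, chartAt_source_shrink]

/-- Extended chart targets of `Shrink M`. [folklore] -/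
theorem extChartAt_target_shrink (x : Shrink.{v} M) :
    (extChartAt I x).target = (extChartAt I (sh M x)).target := by
  simp only [extChartAt, OpenPartialHomeomorph.extend_target, chartAt_target_shrink]

/-! ### §2 `sh`, `sh⁻¹` are smooth: the diffeomorphism `Shrink M ≅ M`; topological instances -/

/-- `Shrink M` is second countable when `M` is. [folklore] -/
instance instSecondCountableTopology [SecondCountableTopology M] :
    SecondCountableTopology (Shrink.{v} M) :=
  (sh M).secondCountableTopology

omit [ChartedSpace H M] in
/-- `Shrink M` is Hausdorff when `M` is. [folklore] -/
instance instT2Space [T2Space M] : T2Space (Shrink.{v} M) :=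
  (sh M).symm.t2Space

omit [ChartedSpace H M] in
/-- `Shrink M` is compact when `M` is. [folklore] -/
instance instCompactSpace [CompactSpace M] : CompactSpace (Shrink.{v} M) :=
  (sh M).symm.compactSpace

omit [ChartedSpace H M] in
/-- `Shrink M` is connected when `M` is. [folklore] -/
instance instConnectedSpace [ConnectedSpace M] : ConnectedSpace (Shrink.{v} M) :=
  (sh M).symm.surjective.connectedSpace (sh M).symm.continuous

variable [IsManifold I n M]

/-- `sh⁻¹ : M → Shrink M` is `Cⁿ` (it is the identity in charts). [folklore] -/
theorem contMDiff_sh_symm : ContMDiff I I n ((sh M).symm : M → Shrink.{v} M) :=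
  Homeomorph.contMDiff_transportChartedSpace (I₀ := I) (n := n) (Shrink.homeomorph M)

/-- `sh : Shrink M → M` is `Cⁿ`. [folklore] -/
theorem contMDiff_sh : ContMDiff I I n (sh M : Shrink.{v} M → M) :=
  Homeomorph.contMDiff_symm_transportChartedSpace (I₀ := I) (n := n) (Shrink.homeomorph M)

/-- **The canonical diffeomorphism `Shrink N ≅ N`** (it is `sh`). [folklore] -/
def diffeomorph (I : ModelWithCorners ℝ E H) (N : Type u) [TopologicalSpace N] [Small.{v} N]
    [ChartedSpace H N] (n : WithTop ℕ∞) [IsManifold I n N] : Shrink.{v} N ≃ₘ^n⟮I, I⟯ N :=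
  (Homeomorph.transportDiffeomorph (I₀ := I) (n := n) (Shrink.homeomorph N)).symm

/-- The diffeomorphism is `sh`. [folklore] -/
@[simp] theorem diffeomorph_apply (x : Shrink.{v} M) : diffeomorph I M n x = sh M x := rfl

/-- Its inverse is `sh⁻¹`. [folklore] -/
@[simp] theorem diffeomorph_symm_apply (x : M) : (diffeomorph.{v} I M n).symm x = (sh M).symm x :=
  rfl

/-- The diffeomorphism as a map is `sh`. [folklore] -/
theorem coe_diffeomorph : ⇑(diffeomorph.{v} I M n) = sh M := rfl

/-- **An orientation of `M` transports to `Shrink M`**: pull back along the canonical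
diffeomorphism `Shrink M ≅ M` (`SmoothOrientation.comap`; Lee (2013), Ch. 15, pullback
orientations). [folklore] -/
def orientation [IsManifold I ∞ M] (o : SmoothOrientation I M) : SmoothOrientation I (Shrink.{v} M) :=
  o.comap (diffeomorph I M ∞) (by simp)

/-- `Shrink M` is orientable when `M` is. [folklore] -/
theorem isOrientable [IsManifold I ∞ M] (h : IsOrientable I M) : IsOrientable I (Shrink.{v} M) := by
  obtain ⟨o⟩ := h
  exact ⟨orientation o⟩

/-! ### §3 Morse data of `f ∘ sh` -/

omit [IsManifold I n M] in
/-- `f ∘ sh` written in the extended chart at `x` is `f` written in the extended chart at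
`sh x` (the same function `E → ℝ`). [folklore] -/
theorem writtenInExtChartAt_comp_sh (f : M → ℝ) (x : Shrink.{v} M) :
    writtenInExtChartAt I 𝓘(ℝ, ℝ) x (f ∘ sh M) = writtenInExtChartAt I 𝓘(ℝ, ℝ) (sh M x) f := by
  funext z
  simp [writtenInExtChartAt]

omit [IsManifold I n M] in
/-- Differentiability of `f ∘ sh` at `x` is differentiability of `f` at `sh x`. [folklore] -/
theorem mdifferentiableAt_comp_sh_iff (f : M → ℝ) (x : Shrink.{v} M) :
    MDifferentiableAt I 𝓘(ℝ, ℝ) (f ∘ sh M) x ↔ MDifferentiableAt I 𝓘(ℝ, ℝ) f (sh M x) := by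
  rw [mdifferentiableAt_iff, mdifferentiableAt_iff, writtenInExtChartAt_comp_sh,
    extChartAt_apply]
  refine and_congr ?_ Iff.rfl
  constructor
  · intro h
    have hx : ContinuousAt (f ∘ sh M) ((sh M).symm (sh M x)) := by rwa [symm_sh_apply]
    have h2 := hx.comp (sh M).symm.continuous.continuousAt
    simpa [Function.comp_def] using h2
  · intro h
    exact h.comp (sh M).continuous.continuousAt

omit [IsManifold I n M] in
/-- **The differential of `f ∘ sh` at `x` is that of `f` at `sh x`** (same extended charts).
[folklore] -/
theorem mfderiv_comp_sh (f : M → ℝ) (x : Shrink.{v} M) :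
    mfderiv I 𝓘(ℝ, ℝ) (f ∘ sh M) x = mfderiv I 𝓘(ℝ, ℝ) f (sh M x) := by
  by_cases h : MDifferentiableAt I 𝓘(ℝ, ℝ) f (sh M x)
  · have h' : MDifferentiableAt I 𝓘(ℝ, ℝ) (f ∘ sh M) x := (mdifferentiableAt_comp_sh_iff f x).2 h
    rw [mfderiv, if_pos h', mfderiv, if_pos h, writtenInExtChartAt_comp_sh, extChartAt_apply]
  · have h' : ¬ MDifferentiableAt I 𝓘(ℝ, ℝ) (f ∘ sh M) x :=
      fun h' => h ((mdifferentiableAt_comp_sh_iff f x).1 h')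
    rw [mfderiv_zero_of_not_mdifferentiableAt h, mfderiv_zero_of_not_mdifferentiableAt h']
    rfl

omit [IsManifold I n M] in
/-- Critical points of `f ∘ sh` correspond to the critical points of `f`. [folklore] -/
theorem isMCriticalPt_comp_sh_iff (f : M → ℝ) (x : Shrink.{v} M) :
    IsMCriticalPt I (f ∘ sh M) x ↔ IsMCriticalPt I f (sh M x) := by
  rw [IsMCriticalPt, IsMCriticalPt, mfderiv_comp_sh]
  exact Iff.rfl

omit [IsManifold I n M] in
/-- **The Hessian of `f ∘ sh` at `x` is the Hessian of `f` at `sh x`** (same extended charts).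
[folklore] -/
theorem mhessian_comp_sh (f : M → ℝ) (x : Shrink.{v} M) :
    mhessian I (f ∘ sh M) x = mhessian I f (sh M x) := by
  simp only [mhessian, writtenInExtChartAt_comp_sh, extChartAt_apply]

omit [IsManifold I n M] in
/-- The Morse index is unchanged. [folklore] -/
theorem morseIndex_comp_sh (f : M → ℝ) (x : Shrink.{v} M) :
    morseIndex I (f ∘ sh M) x = morseIndex I f (sh M x) := by
  rw [morseIndex, morseIndex, mhessian_comp_sh]

omit [IsManifold I n M] in
/-- `crit (f ∘ sh) = sh⁻¹ (crit f)`. [folklore] -/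
theorem criticalSet_comp_sh (f : M → ℝ) :
    criticalSet I (f ∘ sh M) = (sh M : Shrink.{v} M → M) ⁻¹' criticalSet I f := by
  ext x; exact isMCriticalPt_comp_sh_iff f x

omit [IsManifold I n M] in
/-- `Crit_k (f ∘ sh) = sh⁻¹ (Crit_k f)`. [folklore] -/
theorem criticalSetOfIndex_comp_sh (f : M → ℝ) (k : ℕ) :
    criticalSetOfIndex I (f ∘ sh M) k = (sh M : Shrink.{v} M → M) ⁻¹' criticalSetOfIndex I f k := by
  ext x
  simp only [mem_criticalSetOfIndex, mem_preimage, isMCriticalPt_comp_sh_iff, morseIndex_comp_sh]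

omit [IsManifold I n M] in
/-- The number of critical points of index `k` is unchanged. [folklore] -/
theorem ncard_criticalSetOfIndex_comp_sh (f : M → ℝ) (k : ℕ) :
    (criticalSetOfIndex I (f ∘ (sh M : Shrink.{v} M → M)) k).ncard =
      (criticalSetOfIndex I f k).ncard := by
  rw [criticalSetOfIndex_comp_sh, ← image_eq_preimage_of_inverse (sh M).apply_symm_apply
    (sh M).symm_apply_apply, ncard_image_of_injective _ (sh M).symm.injective]

/-- `f ∘ sh` is a Morse function iff `f` is. [folklore] -/
theorem isMorse_comp_sh_iff [IsManifold I ∞ M] (f : M → ℝ) :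
    IsMorse I (f ∘ (sh M : Shrink.{v} M → M)) ↔ IsMorse I f := by
  constructor
  · rintro ⟨hs, hnd⟩
    refine ⟨?_, fun x hx => ?_⟩
    · have := hs.comp (contMDiff_sh_symm (I := I) (M := M) (n := ∞))
      simpa [Function.comp_def] using this
    · have hx' : IsMCriticalPt I (f ∘ sh M) ((sh M).symm x) := by
        rw [isMCriticalPt_comp_sh_iff, sh_symm_apply]; exact hx
      have h := hnd ((sh M).symm x) hx'
      rwa [mhessian_comp_sh, sh_symm_apply] at h
  · rintro ⟨hs, hnd⟩
    refine ⟨hs.comp contMDiff_sh, fun x hx => ?_⟩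
    rw [mhessian_comp_sh]
    exact hnd _ ((isMCriticalPt_comp_sh_iff f x).1 hx)

omit [IsManifold I n M] in
/-- Boundary points of `Shrink M` correspond to boundary points of `M`. [folklore] -/
theorem isBoundaryPoint_iff (x : Shrink.{v} M) :
    I.IsBoundaryPoint x ↔ I.IsBoundaryPoint (sh M x) := by
  rw [ModelWithCorners.IsBoundaryPoint, ModelWithCorners.IsBoundaryPoint, extChartAt_apply]

omit [IsManifold I n M] in
/-- Interior points of `Shrink M` correspond to interior points of `M`. [folklore] -/
theorem isInteriorPoint_iff (x : Shrink.{v} M) :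
    I.IsInteriorPoint x ↔ I.IsInteriorPoint (sh M x) := by
  rw [ModelWithCorners.IsInteriorPoint, ModelWithCorners.IsInteriorPoint, extChartAt_apply]

omit [IsManifold I n M] in
/-- `∂(Shrink M) = sh⁻¹ (∂M)`. [folklore] -/
theorem boundary_eq : I.boundary (Shrink.{v} M) = sh M ⁻¹' I.boundary M := by
  ext x; exact isBoundaryPoint_iff x

omit [IsManifold I n M] in
/-- `∂(Shrink M) = sh⁻¹ '' (∂M)` (image form). [folklore] -/
theorem boundary_eq_image : I.boundary (Shrink.{v} M) = (sh M).symm '' I.boundary M := by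
  rw [boundary_eq, ← image_eq_preimage_of_inverse (sh M).apply_symm_apply (sh M).symm_apply_apply]

omit [IsManifold I n M] in
/-- `sh '' ∂(Shrink M) = ∂M`. [folklore] -/
theorem image_sh_boundary : sh M '' I.boundary (Shrink.{v} M) = I.boundary M := by
  rw [boundary_eq, image_preimage_eq _ (sh M).surjective]

omit [IsManifold I n M] in
/-- `int(Shrink M) = sh⁻¹ (int M)`. [folklore] -/
theorem interior_eq : I.interior (Shrink.{v} M) = sh M ⁻¹' I.interior M := by
  ext x; exact isInteriorPoint_iff x

/-- **A Morse function adapted to the boundary transports to one**: `f ∘ sh` is adapted to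
`∂(Shrink M)` iff `f` is adapted to `∂M`. [folklore] -/
theorem isMorseAdapted_comp_sh_iff [IsManifold I ∞ M] (f : M → ℝ) :
    IsMorseAdapted I (f ∘ (sh M : Shrink.{v} M → M)) ↔ IsMorseAdapted I f := by
  simp only [IsMorseAdapted, isMorse_comp_sh_iff, boundary_eq, interior_eq, mem_preimage,
    Function.comp_apply, isMCriticalPt_comp_sh_iff]
  constructor
  · rintro ⟨h1, h2, h3⟩
    refine ⟨h1, fun x hx => ?_, fun x hx => ?_⟩
    · simpa using h2 ((sh M).symm x) (by simpa using hx)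
    · simpa using h3 ((sh M).symm x) (by simpa using hx)
  · rintro ⟨h1, h2, h3⟩
    exact ⟨h1, fun x hx => h2 (sh M x) hx, fun x hx => h3 (sh M x) hx⟩

/-- **Handle decompositions transport to `Shrink W`** (same Morse function read through `sh`,
same critical points and indices). [folklore] -/
theorem hasHandleDecomposition {m : ℕ} {W : Type u} [TopologicalSpace W] [Small.{v} W]
    [ChartedSpace (EuclideanHalfSpace (m + 1)) W] [IsManifold (𝓡∂ (m + 1)) ∞ W] {c : ℕ → ℕ}
    (h : HasHandleDecomposition m W c) : HasHandleDecomposition m (Shrink.{v} W) c := by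
  obtain ⟨f, hf, hc⟩ := h
  refine ⟨f ∘ sh W, (isMorseAdapted_comp_sh_iff f).2 hf, fun k => ?_⟩
  rw [ncard_criticalSetOfIndex_comp_sh, hc]

end ManifoldShrink

end Literature.Topology.FourManifolds

end
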